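import Summits.RiemannHypothesis.RiemannHypothesis.Theses.WeilWindowFlow
import Summits.RiemannHypothesis.RiemannHypothesis.Theorems.WeilWindowFlowStrictArchimedeanBottom
import Literature.NumberTheory.LFunctions.WeilWindowSuzukiContinuityProofs
import HarnessLib

/-!
# Route WeilWindowFlow — support item `PrimeTwoWindow` (stmt-RiemannHypothesis-1040)

`∃ a > (log 2)/2, WeilPositivityOn a`: Weil positivity holds on SOME window `[-a, a]` with `2a > log 2`, i.e.
with the prime `2` genuinely present in `W(g ⋆ g̃)` — the first step past the proved archimedean (Yoshida–Bombieri)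
range. The "soft route" of the item text, now available from landed tree theorems only:

* `strictArchimedeanBottom_proof` (item 1042): `0 < ε((log 2)/2)`, `ε = weilGroundEnergy`;
* `continuousAt_weilGroundEnergy` (Suzuki 2026 Thm 1.3, discharged; item 1041 `WindowContinuity`):
  `ε` is continuous at `(log 2)/2`, hence `0 < ε x` for all `x` near `(log 2)/2`, in particular for some
  `x > (log 2)/2`;
* `weilGroundEnergy_nonneg_iff_holds` (Bombieri 2000 §4 / Yoshida): `0 ≤ ε x ↔ WeilPositivityOn x` for `x > 0`.

Axioms ⊆ {propext, Classical.choice, Quot.sound}.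
-/

-- `Summit.RiemannHypothesis.RiemannHypothesis.…` repeats a namespace component by design (D-0017 layout).
set_option linter.dupNamespace false

noncomputable section

open Filter Set
open scoped Topology

namespace Summit.RiemannHypothesis.RiemannHypothesis.Theorems

open Literature.NumberTheory.LFunctions

/-- **Item `PrimeTwoWindow` (stmt-RiemannHypothesis-1040) of route `WeilWindowFlow`, proved.** There is a window
half-width `a > (log 2)/2` with `WeilPositivityOn a`: strict positivity of the bottom at the dyadic window
(`strictArchimedeanBottom_proof`) persists slightly to the right by continuity of `ε`
(`continuousAt_weilGroundEnergy`), and `0 ≤ ε x` is Weil positivity on `[-x, x]`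
(`weilGroundEnergy_nonneg_iff_holds`). [folklore] -/
theorem primeTwoWindow_proof :
    Summit.RiemannHypothesis.RiemannHypothesis.Theses.WeilWindowFlow.PrimeTwoWindow := by
  unfold Summit.RiemannHypothesis.RiemannHypothesis.Theses.WeilWindowFlow.PrimeTwoWindow
  have ha₀ : 0 < Real.log 2 / 2 := by
    have := Real.log_pos one_lt_two
    positivity
  have hpos : 0 < weilGroundEnergy (Real.log 2 / 2) := strictArchimedeanBottom_proof
  have hcont : ContinuousAt weilGroundEnergy (Real.log 2 / 2) := continuousAt_weilGroundEnergy ha₀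
  -- `ε > 0` on a neighbourhood of the dyadic window, in particular just to the right of it
  have hev : ∀ᶠ x in 𝓝 (Real.log 2 / 2), 0 < weilGroundEnergy x :=
    hcont.eventually (lt_mem_nhds hpos)
  have hev' : ∀ᶠ x in 𝓝[>] (Real.log 2 / 2), 0 < weilGroundEnergy x ∧ Real.log 2 / 2 < x :=
    (hev.filter_mono nhdsWithin_le_nhds).and self_mem_nhdsWithin
  obtain ⟨x, hx, hxa⟩ := hev'.exists
  exact ⟨x, hxa, (weilGroundEnergy_nonneg_iff_holds (ha₀.trans hxa)).1 hx.le⟩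

end Summit.RiemannHypothesis.RiemannHypothesis.Theorems

end
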